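import Summits.KontsevichZagierPeriods.KontsevichZagierPeriods.Theorems.SymplecticScissorsVolumeFormOffPlaneUnionSplit

/-!
# `VolumeFormOffPlane` (stmt-KontsevichZagierPeriods-14935) — line `Sketch`,
stub `stub_scissors` (SIGNED SCISSORS: an a.e. indicator identity is a relation)

The keystone of the line's v6 layer. If finitely many integrand-`1` representations `ρ i`
(`i : Fin k`) of one dimension `N` and integers `ε i` satisfy
`∑ i, ε i · 1_{(ρ i).domain} = 0` almost everywhere, then `∑ i, ε i • [ρ i]` lies in
`KZ.relations` (`Literature/NumberTheory/Transcendental/KZCalculus.lean`). Consequently the class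
map `ρ ↦ [ρ]` on integrand-`1` representations factors through the scissors-congruence group of
`ℚ`-semialgebraic sets modulo null sets.

Proof. Refine to the ATOMS `A S = {x | ∀ j, x ∈ (ρ j).domain ↔ j ∈ S}` (`S : Finset (Fin k)`)
of the finite Boolean algebra generated by the domains; each is `ℚ`-semialgebraic
(`IsSemialgebraic.biInter`, `.compl`). Every `[ρ i]` splits over its atoms `S ∋ i` by iterated
domain additivity (`KZ.of_sub_sum_of_mem_relations`, all exceptional sets empty). Exchanging the
two finite sums regroups `∑ i, ε i • [ρ i]` as `∑ S, ∑ i ∈ S, ε i • [ρ i |_{A S}]`. On a null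
atom every piece is a relation (`KZ.of_mem_relations_of_volume_eq_zero`); on an atom of positive
measure the pieces `[ρ i |_{A S}]`, `i ∈ S`, are pairwise congruent (same domain, integrand `1`:
`KZ.of_sub_of_mem_relations_of_eqOn`), so the inner sum is `(∑ i ∈ S, ε i) • [ρ i₀ |_{A S}]`,
and the atom carries a point of the a.e. identity, where it reads `∑ i ∈ S, ε i = 0`.

Sources: Kontsevich–Zagier 2001, §1.2, rule (1) (domain additivity); folklore (inclusion–exclusion
over the atoms of a finite Boolean algebra).
-/

noncomputable section

open MeasureTheory Set
open Literature.NumberTheory.Transcendental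
open Literature.ModelTheory.ExponentialFields (IsSemialgebraic)

namespace Summit.KontsevichZagierPeriods.SymplecticScissors.LogPolytope

variable {N k : ℕ}

/-- The atom `{x | ∀ j, x ∈ (ρ j).domain ↔ j ∈ S}` of the Boolean algebra generated by the
domains of finitely many integral representations is `ℚ`-semialgebraic (a finite intersection of
domains and complements of domains). [folklore] -/
theorem sci_isSemialgebraic_atom (ρ : Fin k → KZ.IntegralRep N) (S : Finset (Fin k)) :
    IsSemialgebraic ℚ {x : Fin N → ℝ | ∀ j, x ∈ (ρ j).domain ↔ j ∈ S} := by
  classical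
  have h : {x : Fin N → ℝ | ∀ j, x ∈ (ρ j).domain ↔ j ∈ S} =
      ⋂ j ∈ (Finset.univ : Finset (Fin k)),
        (if j ∈ S then (ρ j).domain else (ρ j).domainᶜ) := by
    ext x
    simp only [mem_setOf_eq, mem_iInter, Finset.mem_univ, true_imp_iff]
    refine forall_congr' fun j => ?_
    split_ifs with hj
    · simp [hj]
    · simp [hj]
  rw [h]
  exact IsSemialgebraic.biInter _ _ fun j _ => by
    split_ifs
    · exact (ρ j).isSemialgebraic_domain
    · exact (ρ j).isSemialgebraic_domain.compl

/-- A point of an atom lies in exactly the domains indexed by the atom. [folklore] -/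
theorem sci_mem_domain_of_mem_atom {ρ : Fin k → KZ.IntegralRep N} {S : Finset (Fin k)}
    {x : Fin N → ℝ} (hx : x ∈ {x : Fin N → ℝ | ∀ j, x ∈ (ρ j).domain ↔ j ∈ S}) {i : Fin k}
    (hi : i ∈ S) : x ∈ (ρ i).domain :=
  (hx i).mpr hi

/-- Distinct atoms are disjoint. [folklore] -/
theorem sci_atom_inter_atom_eq_empty (ρ : Fin k → KZ.IntegralRep N) {S T : Finset (Fin k)}
    (hST : S ≠ T) :
    {x : Fin N → ℝ | ∀ j, x ∈ (ρ j).domain ↔ j ∈ S} ∩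
      {x : Fin N → ℝ | ∀ j, x ∈ (ρ j).domain ↔ j ∈ T} = ∅ := by
  ext x
  simp only [mem_inter_iff, mem_setOf_eq, mem_empty_iff_false, iff_false, not_and]
  intro hS hT
  exact hST (Finset.ext fun j => (hS j).symm.trans (hT j))

/-- Every point of a domain lies in the atom indexed by the set of domains containing it.
[folklore] -/
theorem sci_mem_atom_filter (ρ : Fin k → KZ.IntegralRep N) (x : Fin N → ℝ)
    [DecidablePred fun j => x ∈ (ρ j).domain] :
    x ∈ {y : Fin N → ℝ | ∀ j, y ∈ (ρ j).domain ↔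
      j ∈ Finset.univ.filter fun j => x ∈ (ρ j).domain} := by
  intro j
  simp

/-- On an atom, the weighted indicator sum of the a.e. identity reads `∑ i ∈ S, ε i`.
[folklore] -/
theorem sci_sum_indicator_eq_of_mem_atom {ρ : Fin k → KZ.IntegralRep N} {S : Finset (Fin k)}
    (ε : Fin k → ℤ) {x : Fin N → ℝ}
    (hx : x ∈ {x : Fin N → ℝ | ∀ j, x ∈ (ρ j).domain ↔ j ∈ S}) :
    ∑ i, (ε i : ℝ) * (ρ i).domain.indicator (fun _ => (1 : ℝ)) x = ((∑ i ∈ S, ε i : ℤ) : ℝ) := by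
  classical
  have hind : ∀ i, (ρ i).domain.indicator (fun _ => (1 : ℝ)) x = if i ∈ S then 1 else 0 := by
    intro i
    by_cases hi : i ∈ S
    · simp [hi, (hx i).mpr hi]
    · have hxi : x ∉ (ρ i).domain := fun h => hi ((hx i).mp h)
      simp [hi, hxi]
  simp only [hind, mul_ite, mul_one, mul_zero]
  rw [Finset.sum_ite_mem, Finset.univ_inter]
  push_cast
  rfl

/-- **Stub v6-1 (SIGNED SCISSORS).** If finitely many integrand-`1` representations `ρ i` of one
dimension and integers `ε i` satisfy `∑ i, ε i · 1_{(ρ i).domain} = 0` almost everywhere, then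
`∑ i, ε i • [ρ i]` is a relation of the Kontsevich–Zagier calculus: refine to the atoms of the
finite Boolean algebra generated by the domains (each `ℚ`-semialgebraic), split every `[ρ i]`
over its atoms by rule (1a), identify atom pieces of equal domain (congruence), and observe that
an atom of positive measure carries a point of the identity, where it reads `∑ i ∈ S, ε i = 0`,
while null atoms are relations. The class map factors through the scissors-congruence group.
[Kontsevich–Zagier 2001, §1.2, rule (1); folklore] -/
theorem stub_scissors : ∀ (N k : ℕ) (ρ : Fin k → KZ.IntegralRep N) (ε : Fin k → ℤ),
    (∀ i, ∀ x ∈ (ρ i).domain, (ρ i).integrand x = 1) →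
    (∀ᵐ x : Fin N → ℝ, ∑ i, (ε i : ℝ) * (ρ i).domain.indicator (fun _ => (1 : ℝ)) x = 0) →
    ∑ i, ε i • KZ.of (ρ i) ∈ KZ.relations := by
  intro N k ρ ε hone hae
  classical
  -- the atoms and the atom pieces `a i S = ρ i |_{A S ∩ (ρ i).domain}`
  set A : Finset (Fin k) → Set (Fin N → ℝ) :=
    fun S => {x : Fin N → ℝ | ∀ j, x ∈ (ρ j).domain ↔ j ∈ S} with hA
  have hAsa : ∀ S, IsSemialgebraic ℚ (A S) := fun S => sci_isSemialgebraic_atom ρ S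
  let a : Fin k → Finset (Fin k) → KZ.IntegralRep N := fun i S =>
    (ρ i).restrict (A S ∩ (ρ i).domain) ((hAsa S).inter (ρ i).isSemialgebraic_domain)
      inter_subset_right
  have ha_dom : ∀ i S, (a i S).domain = A S ∩ (ρ i).domain := fun i S => rfl
  have ha_int : ∀ i S, (a i S).integrand = (ρ i).integrand := fun i S => rfl
  have hAsub : ∀ {S : Finset (Fin k)} {i : Fin k}, i ∈ S → A S ⊆ (ρ i).domain :=
    fun hi x hx => sci_mem_domain_of_mem_atom hx hi
  have ha_dom' : ∀ {S : Finset (Fin k)} {i : Fin k}, i ∈ S → (a i S).domain = A S :=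
    fun hi => by rw [ha_dom, inter_eq_left.mpr (hAsub hi)]
  -- the atoms containing `i`
  let P : Fin k → Finset (Finset (Fin k)) := fun i => Finset.univ.filter fun S => i ∈ S
  have hP : ∀ {i S}, S ∈ P i ↔ i ∈ S := by intro i S; simp [P]
  -- Step 1: every `[ρ i]` splits over its atoms
  have hsplit : ∀ i, KZ.of (ρ i) - ∑ S ∈ P i, KZ.of (a i S) ∈ KZ.relations := by
    intro i
    refine KZ.of_sub_sum_of_mem_relations (P i) (ρ i) (a i) ?_ ?_ ?_ ?_
    · intro S _
      rw [ha_dom, sdiff_eq_empty.mpr inter_subset_right, measure_empty]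
    · intro S _ x _
      rw [ha_int]
    · have hcov : (ρ i).domain \ ⋃ S ∈ P i, (a i S).domain = ∅ := by
        refine sdiff_eq_empty.mpr fun x hx => ?_
        simp only [mem_iUnion, exists_prop]
        refine ⟨Finset.univ.filter fun j => x ∈ (ρ j).domain, hP.mpr (by simp [hx]), ?_⟩
        rw [ha_dom]
        exact ⟨sci_mem_atom_filter ρ x, hx⟩
      rw [hcov, measure_empty]
    · intro S _ T _ hST
      have h0 : (a i S).domain ∩ (a i T).domain = ∅ := by
        rw [ha_dom, ha_dom]
        have := sci_atom_inter_atom_eq_empty ρ hST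
        refine eq_empty_of_subset_empty fun x hx => ?_
        rw [← this]
        exact ⟨hx.1.1, hx.2.1⟩
      rw [h0, measure_empty]
  -- Step 2: replace every `[ρ i]` by the sum of its atom pieces
  have hstep2 : ∑ i, ε i • KZ.of (ρ i) - ∑ i, ε i • ∑ S ∈ P i, KZ.of (a i S) ∈ KZ.relations :=
    KZ.sum_sub_sum_mem_relations _ _ _ fun i _ => by
      rw [← zsmul_sub]
      exact KZ.relations.zsmul_mem (hsplit i) _
  -- Step 3: exchange the sums: `∑ i, ε i • ∑_{S ∋ i} [a i S] = ∑ S, ∑ i ∈ S, ε i • [a i S]`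
  have hcomm : ∑ i, ε i • ∑ S ∈ P i, KZ.of (a i S) =
      ∑ S : Finset (Fin k), ∑ i ∈ S, ε i • KZ.of (a i S) := by
    have h1 : ∀ i, ε i • ∑ S ∈ P i, KZ.of (a i S) =
        ∑ S : Finset (Fin k), if i ∈ S then ε i • KZ.of (a i S) else 0 := by
      intro i
      rw [Finset.smul_sum, Finset.sum_filter]
    simp only [h1]
    rw [Finset.sum_comm]
    refine Finset.sum_congr rfl fun S _ => ?_
    rw [Finset.sum_ite_mem, Finset.univ_inter]
  -- Step 4: every atom contributes a relation
  have hatom : ∀ S : Finset (Fin k), ∑ i ∈ S, ε i • KZ.of (a i S) ∈ KZ.relations := by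
    intro S
    by_cases hnull : volume (A S) = 0
    · -- null atom: every piece is a relation
      refine sum_mem fun i _ => KZ.relations.zsmul_mem ?_ _
      exact KZ.of_mem_relations_of_volume_eq_zero (a i S)
        (measure_mono_null (by rw [ha_dom]; exact inter_subset_left) hnull)
    · -- atom of positive measure
      rcases S.eq_empty_or_nonempty with hS | ⟨i₀, hi₀⟩
      · simp [hS, KZ.relations.zero_mem]
      -- the pieces are pairwise congruent
      have hcongr : ∀ i ∈ S, ε i • KZ.of (a i S) - ε i • KZ.of (a i₀ S) ∈ KZ.relations := by
        intro i hi
        rw [← zsmul_sub]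
        refine KZ.relations.zsmul_mem (KZ.of_sub_of_mem_relations_of_eqOn ?_ ?_) _
        · rw [ha_dom' hi, ha_dom' hi₀]
        · intro x hx
          rw [ha_dom' hi] at hx
          rw [ha_int, ha_int, hone i x (hAsub hi hx), hone i₀ x (hAsub hi₀ hx)]
      have hsum : ∑ i ∈ S, ε i • KZ.of (a i S) - (∑ i ∈ S, ε i) • KZ.of (a i₀ S) ∈
          KZ.relations := by
        rw [Finset.sum_smul]
        exact KZ.sum_sub_sum_mem_relations S _ _ hcongr
      -- the atom carries a point of the a.e. identity, where it reads `∑ i ∈ S, ε i = 0`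
      have hzero : ∑ i ∈ S, ε i = 0 := by
        have hbad : volume {x : Fin N → ℝ |
            ¬ (∑ i, (ε i : ℝ) * (ρ i).domain.indicator (fun _ => (1 : ℝ)) x = 0)} = 0 :=
          ae_iff.mp hae
        obtain ⟨x, hxA, hx⟩ : ∃ x ∈ A S,
            ∑ i, (ε i : ℝ) * (ρ i).domain.indicator (fun _ => (1 : ℝ)) x = 0 := by
          by_contra hcon
          push Not at hcon
          exact hnull (measure_mono_null (fun x hx => hcon x hx) hbad)
        rw [sci_sum_indicator_eq_of_mem_atom ε hxA] at hx
        exact_mod_cast hx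
      have : ∑ i ∈ S, ε i • KZ.of (a i S) =
          (∑ i ∈ S, ε i • KZ.of (a i S) - (∑ i ∈ S, ε i) • KZ.of (a i₀ S)) +
            (∑ i ∈ S, ε i) • KZ.of (a i₀ S) := by abel
      rw [this]
      refine KZ.relations.add_mem hsum ?_
      rw [hzero, zero_smul]
      exact KZ.relations.zero_mem
  -- conclusion
  have hrest : ∑ i, ε i • ∑ S ∈ P i, KZ.of (a i S) ∈ KZ.relations := by
    rw [hcomm]
    exact sum_mem fun S _ => hatom S
  have : ∑ i, ε i • KZ.of (ρ i) =
      (∑ i, ε i • KZ.of (ρ i) - ∑ i, ε i • ∑ S ∈ P i, KZ.of (a i S)) +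
        ∑ i, ε i • ∑ S ∈ P i, KZ.of (a i S) := by abel
  rw [this]
  exact KZ.relations.add_mem hstep2 hrest

end Summit.KontsevichZagierPeriods.SymplecticScissors.LogPolytope

end
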